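import Literature.Analysis.FluidPDE.PlanarLiftCalculus
import Literature.Analysis.FluidPDE.KNSSLiouville
import Literature.Analysis.FluidPDE.WeakGradientIBP
import HarnessLib

/-!
# Planar lifts, II: bounded weak Navier–Stokes solutions lift from `ℝ²` to `ℝ³`

Analysis/FluidPDE support file (everything proved; no named facts) on the discharge path of the
named fact `Literature.Analysis.FluidPDE.KNSS2009_regularity_boundedWeak_ancient_planar`
(`KNSSRegularityPlanar`; Koch–Nadirashvili–Seregin–Šverák, Acta Math. 203 (2009) =
arXiv:0709.3599, §4 for bounded weak solutions on `ℝ² × (−∞, 0)`), which the tree reduces to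
its `ℝ³` twin `KNSS2009_regularity_boundedWeak_ancient` (`KNSSRegularityPlanarOfSpace`) through
the classical remark that a planar flow is a spatial flow independent of `x₂` without vertical
velocity (Majda–Bertozzi 2002, §2.3.1, `2½`-dimensional flows with `u₃ ≡ 0`). This file proves
the one statement about KNSS's class of **bounded weak solutions** (§4 (ii), p. 8:
`u ∈ L^∞`, `div u = 0` in distributions, `∫∫ u·(φₜ + Δφ) + u_k u·∂_k φ = 0` for all smooth
compactly supported divergence-free `φ`; the tree's `IsBoundedWeakNSSolutionOn`) that the
reduction needs:

* `IsBoundedWeakNSSolutionOn.planarLift` — if `u` is a bounded weak solution on `ℝ² × I`, then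
  `planarLift u`, `(t, x) ↦ (u(t, x₀, x₁), 0)`, is a bounded weak solution on `ℝ³ × I` with the
  same viscosity.

The proof is Fubini along the vertical fibres (`cylSplit : ℝ³ ≃ᵐ ℝ × ℝ²`, volume preserving):
measurability and the bound move along the quasi-measure-preserving projection
(`quasiMeasurePreserving_projXY`); a scalar test function `θ` on `ℝ³` tests the lift of a
weakly divergence-free slice through the planar test function `vertInt θ`
(`IsWeaklyDivFree.planarLift_slice`); and a divergence-free space–time test field `ψ` on
`I × ℝ³` tests the lift through the fibre integral `ψ̄ = fiberInt (π ∘ ψ)` of its horizontal part,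
which is a space–time test field on `I × ℝ²` (`PlanarLiftCalculus`) with divergence-free slices
(`isDivFree_vertInt_projXY`: `div_w ∫ πψ dz = ∫ (div ψ − ∂_z ψ_z) dz = 0`), the three terms of the
weak identity matching slice by slice (`integral_planarLift_pairing_eq`: `∂ₜ`, `D`, `Δ` pass
under the fibre integral).

## Mathlib / tree search

Tree: `IsBoundedWeakNSSolutionOn` and its projections (`KNSSLiouville`); `IsWeaklyDivFree`,
`IsSpaceTimeTestOn`, `timeDeriv`, `convect`, `divergence_eq_sum_inner_fderiv`
(`VectorCalculus`, `WeakSolution`); `cylSplit`, `integral_eq_integral_cylSplit`,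
`integrable_comp_cylSplit_symm_iff` (`CylindricalIntegration`); `projXY`, `embedXY`, `vertInt`,
`fiberInt` and their calculus (`PlanarLiftCalculus`); the time/space translation analogues
`IsBoundedWeakNSSolutionOn.comp_add_right` / `.comp_add_space` (`KNSSRegularityGluing`,
`BoundedWeakTranslate`) were the models. No prior lift of weak solutions between dimensions in
the tree (`lean search 'planarLift|twoHalf.*Weak|IsBoundedWeakNSSolutionOn.*lift'`: only the
classical torus `2½`-D fields of `TwoHalfNavierStokes`). Mathlib: `integral_prod_symm`,
`Measure.ae_ae_of_ae_prod`, `AEStronglyMeasurable.prodMk_left`,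
`MeasureTheory.QuasiMeasurePreserving.prodMap`, `Measure.quasiMeasurePreserving_snd`,
`inner_gradient_left`, `integral_inner`, `isBoundedBilinearMap_apply`; the tree's
`fderiv_inner_const_left_apply` (`WeakGradientIBP`) for `∂ᵥ⟪c, W⟫ = ⟪c, ∂ᵥW⟫`.

## References

* G. Koch, N. Nadirashvili, G. Seregin, V. Šverák, *Liouville theorems for the Navier–Stokes
  equations and applications*, Acta Math. 203 (2009) 83–105 = arXiv:0709.3599, §4 (ii) p. 8
  (bounded weak solutions) and Theorem 5.1 p. 9. [KochNadirashviliSereginSverak2009]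
* A. J. Majda, A. L. Bertozzi, *Vorticity and Incompressible Flow*, CUP 2002, §2.3.1.
  [MajdaBertozziCUP2002]
-/

noncomputable section

open MeasureTheory Set Function Filter Topology TopologicalSpace Metric WithLp
open scoped RealInnerProductSpace ContDiff Laplacian

namespace Literature.Analysis.FluidPDE

/-- Local notation for physical space `ℝ³ = EuclideanSpace ℝ (Fin 3)`. -/
local notation "ℝ³" => EuclideanSpace ℝ (Fin 3)

/-- Local notation for the horizontal plane `ℝ² = EuclideanSpace ℝ (Fin 2)`. -/
local notation "ℝ²" => EuclideanSpace ℝ (Fin 2)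

section Lift

/-- The **planar (`2½`-dimensional) lift** of a time-dependent planar velocity field:
`planarLift u t x = (u t (x₀, x₁), 0)`, a field on `ℝ³` which does not depend on `x₂` and has
no vertical component (Majda–Bertozzi 2002, §2.3.1 with `u₃ ≡ 0`). [folklore] -/
def planarLift (u : ℝ → ℝ² → ℝ²) (t : ℝ) (x : ℝ³) : ℝ³ :=
  embedXY (u t (projXY x))

/-- Unfolding `planarLift`. [folklore] -/
@[simp]
theorem planarLift_apply (u : ℝ → ℝ² → ℝ²) (t : ℝ) (x : ℝ³) :
    planarLift u t x = embedXY (u t (projXY x)) := rfl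

/-- The lift is invariant under vertical translations. [folklore] -/
theorem planarLift_add_smul_eZ (u : ℝ → ℝ² → ℝ²) (t : ℝ) (x : ℝ³) (z : ℝ) :
    planarLift u t (x + z • eZ) = planarLift u t x := by
  simp

/-- The lift in the split variables: `planarLift u t (w₀, w₁, z) = ι (u t w)`. [folklore] -/
theorem planarLift_cylSplit_symm (u : ℝ → ℝ² → ℝ²) (t z : ℝ) (w : ℝ²) :
    planarLift u t (cylSplit.symm (z, w)) = embedXY (u t w) := by
  simp

/-- `‖planarLift u t x‖ = ‖u t (π x)‖`. [folklore] -/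
theorem norm_planarLift (u : ℝ → ℝ² → ℝ²) (t : ℝ) (x : ℝ³) :
    ‖planarLift u t x‖ = ‖u t (projXY x)‖ := by
  simp

/-! #### Measure theory of the projection -/

/-- The horizontal projection is quasi-measure-preserving for Lebesgue measure (it is the
second component of the volume-preserving `cylSplit`). [folklore] -/
theorem quasiMeasurePreserving_projXY :
    Measure.QuasiMeasurePreserving (projXY : ℝ³ → ℝ²) volume volume := by
  have h : (projXY : ℝ³ → ℝ²) = Prod.snd ∘ cylSplit := funext fun x => (cylSplit_apply_snd x).symm
  rw [h]
  exact Measure.quasiMeasurePreserving_snd.comp measurePreserving_cylSplit.quasiMeasurePreserving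

/-- `(t, x) ↦ (t, π x)` is quasi-measure-preserving between the slab measures. [folklore] -/
theorem quasiMeasurePreserving_prodMap_projXY (I : Set ℝ) :
    Measure.QuasiMeasurePreserving (Prod.map id projXY : ℝ × ℝ³ → ℝ × ℝ²)
      ((volume : Measure (ℝ × ℝ³)).restrict (I ×ˢ univ))
      ((volume : Measure (ℝ × ℝ²)).restrict (I ×ˢ univ)) := by
  rw [show (volume : Measure (ℝ × ℝ³)).restrict (I ×ˢ univ) = (volume.restrict I).prod volume from
      (Measure.restrict_prod_eq_prod_univ I).symm,
    show (volume : Measure (ℝ × ℝ²)).restrict (I ×ˢ univ) = (volume.restrict I).prod volume from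
      (Measure.restrict_prod_eq_prod_univ I).symm]
  exact MeasureTheory.QuasiMeasurePreserving.prodMap (Measure.QuasiMeasurePreserving.id _)
    quasiMeasurePreserving_projXY

/-- Composition with the projection preserves a.e. strong measurability of spatial fields.
[folklore] -/
theorem aestronglyMeasurable_comp_projXY {β : Type*} [TopologicalSpace β]
    {v : ℝ² → β} (hv : AEStronglyMeasurable v volume) :
    AEStronglyMeasurable (fun x : ℝ³ => v (projXY x)) volume :=
  hv.comp_quasiMeasurePreserving quasiMeasurePreserving_projXY

/-- The lift of an a.e. strongly measurable space–time field on the slab is a.e. strongly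
measurable on the lifted slab. [folklore] -/
theorem aestronglyMeasurable_uncurry_planarLift {I : Set ℝ} {u : ℝ → ℝ² → ℝ²}
    (h : AEStronglyMeasurable (uncurry u) ((volume : Measure (ℝ × ℝ²)).restrict (I ×ˢ univ))) :
    AEStronglyMeasurable (uncurry (planarLift u))
      ((volume : Measure (ℝ × ℝ³)).restrict (I ×ˢ univ)) := by
  have heq : uncurry (planarLift u) = embedXY ∘ uncurry u ∘ Prod.map id projXY := by
    funext q; obtain ⟨t, x⟩ := q; rfl
  rw [heq]
  exact embedXY.continuous.comp_aestronglyMeasurable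
    (h.comp_quasiMeasurePreserving (quasiMeasurePreserving_prodMap_projXY I))

end Lift


section DivFree

variable {F : Type*} [NormedAddCommGroup F] [NormedSpace ℝ F]

/-- The fibre integral of a compactly supported field is supported in the horizontal shadow
of the support. [folklore] -/
theorem hasCompactSupport_vertInt {Φ : ℝ³ → F} (hΦ : HasCompactSupport Φ) :
    HasCompactSupport (vertInt Φ) := by
  refine HasCompactSupport.intro (hΦ.image projXY.continuous) fun w hw => ?_
  have hzero : ∀ z : ℝ, Φ (embedXY w + z • eZ) = 0 := fun z => by
    by_contra hne
    exact hw ⟨embedXY w + z • eZ, subset_tsupport _ hne, by simp⟩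
  simp [vertInt, lineIntegralAlong, hzero]

/-- Fibre integrals of test functions on `ℝ³` are test functions on `ℝ²`. [folklore] -/
theorem isTestFunctionOn_vertInt {θ : ℝ³ → F}
    (hθ : FunctionSpaces.IsTestFunctionOn (⊤ : Opens ℝ³) θ) :
    FunctionSpaces.IsTestFunctionOn (⊤ : Opens ℝ²) (vertInt θ) :=
  ⟨contDiff_vertInt hθ.contDiff hθ.hasCompactSupport, hasCompactSupport_vertInt hθ.hasCompactSupport,
    by simp⟩

omit [NormedSpace ℝ F] in
/-- Along a vertical fibre, a continuous compactly supported field on `ℝ³` is integrable.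
[folklore] -/
theorem integrable_fiber {Φ : ℝ³ → F} (hΦ : Continuous Φ) (hΦc : HasCompactSupport Φ) (w : ℝ²) :
    Integrable (fun z : ℝ => Φ (embedXY w + z • eZ)) :=
  integrable_comp_linePencil eZ_ne_zero hΦ hΦc w

/-- A pairing `x ↦ A(x)(b(x))` of a continuous compactly supported operator field with a bounded
a.e. strongly measurable vector field is integrable. [folklore] -/
theorem integrable_clm_apply_of_hasCompactSupport {X : Type*}
    [MeasurableSpace X] [TopologicalSpace X] [OpensMeasurableSpace X] [SecondCountableTopology X]
    {μ : Measure X}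
    [IsFiniteMeasureOnCompacts μ]
    {G : Type*} [NormedAddCommGroup G] [NormedSpace ℝ G]
    {A : X → G →L[ℝ] F} (hA : Continuous A) (hAc : HasCompactSupport A)
    {b : X → G} (hb : AEStronglyMeasurable b μ) {C : ℝ} (hC : ∀ x, ‖b x‖ ≤ C) :
    Integrable (fun x => A x (b x)) μ := by
  refine Integrable.mono' ((hA.integrable_of_hasCompactSupport hAc).norm.mul_const C)
    (isBoundedBilinearMap_apply.continuous.comp_aestronglyMeasurable
      (hA.aestronglyMeasurable.prodMk hb)) (Eventually.of_forall fun x => ?_)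
  exact (ContinuousLinearMap.le_opNorm _ _).trans (by gcongr; exact hC x)

/-- **Weak divergence-freeness lifts.** If `v : ℝ² → ℝ²` is bounded, a.e. strongly measurable
and weakly divergence free, then `x ↦ (v(x₀, x₁), 0)` is weakly divergence free on `ℝ³`: test
against `θ ∈ C_c^∞(ℝ³)`, integrate over the fibres first (Fubini along `cylSplit`), and
recognise `∫ Dθ(ι w + z e_z)(ι v(w)) dz = D(vertInt θ)(w)(v(w))`, the pairing of `v` with the
gradient of the planar test function `vertInt θ`. [folklore] -/
theorem IsWeaklyDivFree.planarLift_slice {v : ℝ² → ℝ²} (hv : IsWeaklyDivFree v)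
    (hvm : AEStronglyMeasurable v volume) {C : ℝ} (hC : ∀ w, ‖v w‖ ≤ C) :
    IsWeaklyDivFree (fun x : ℝ³ => embedXY (v (projXY x))) := by
  intro θ hθ
  have hig : ∀ (x : ℝ³) (a : ℝ³), ⟪a, gradient θ x⟫ = fderiv ℝ θ x a := fun x a => by
    rw [real_inner_comm, inner_gradient_left]
  simp_rw [hig]
  set G : ℝ³ → ℝ := fun x => fderiv ℝ θ x (embedXY (v (projXY x))) with hG
  have hGi : Integrable G := by
    refine integrable_clm_apply_of_hasCompactSupport (hθ.contDiff.continuous_fderiv (by simp))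
      (hθ.hasCompactSupport.fderiv ℝ) (embedXY.continuous.comp_aestronglyMeasurable (aestronglyMeasurable_comp_projXY hvm))
      (C := C) fun x => ?_
    rw [norm_embedXY]; exact hC _
  change ∫ x, G x = 0
  rw [integral_eq_integral_cylSplit, Measure.volume_eq_prod,
    integral_prod_symm _ (integrable_comp_cylSplit_symm_iff.2 hGi)]
  have hinner : ∀ w : ℝ², ∫ z : ℝ, G (cylSplit.symm (z, w)) = ⟪v w, gradient (vertInt θ) w⟫ := by
    intro w
    rw [real_inner_comm, inner_gradient_left,
      fderiv_vertInt_apply hθ.contDiff hθ.hasCompactSupport, vertInt_apply]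
    refine integral_congr_ae (Eventually.of_forall fun z => ?_)
    simp [hG, cylSplit_symm_eq]
  simp_rw [hinner]
  exact hv _ (isTestFunctionOn_vertInt hθ)

end DivFree

section TestFields

variable {F : Type*} [NormedAddCommGroup F] [NormedSpace ℝ F]
variable {G : Type*} [NormedAddCommGroup G] [NormedSpace ℝ G]
variable {X : Type*} [NormedAddCommGroup X] [NormedSpace ℝ X]

/-- Post-composition with a continuous linear map preserves space–time test fields. [folklore] -/
theorem IsSpaceTimeTestOn.clm_comp_left {Q : Opens (ℝ × X)} {ψ : ℝ → X → F}
    (hψ : IsSpaceTimeTestOn Q ψ) (L : F →L[ℝ] G) :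
    IsSpaceTimeTestOn Q (fun t x => L (ψ t x)) := by
  have heq : uncurry (fun t x => L (ψ t x)) = L ∘ uncurry ψ := rfl
  refine ⟨?_, ?_, ?_⟩
  · rw [heq]; exact L.contDiff.comp hψ.contDiff
  · rw [heq]; exact hψ.hasCompactSupport.comp_left (map_zero L)
  · rw [heq]; exact (tsupport_comp_subset (map_zero L) _).trans hψ.tsupport_subset

/-- Time derivatives commute with post-composition by a continuous linear map. [folklore] -/
theorem IsSpaceTimeTestOn.timeDeriv_clm_comp_left {Q : Opens (ℝ × X)} {ψ : ℝ → X → F}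
    (hψ : IsSpaceTimeTestOn Q ψ) (L : F →L[ℝ] G) (t : ℝ) (x : X) :
    timeDeriv (fun t x => L (ψ t x)) t x = L (timeDeriv ψ t x) := by
  rw [timeDeriv, timeDeriv]
  exact (L.hasFDerivAt.comp_hasDerivAt t (hψ.hasDerivAt_time t x)).deriv

/-- Spatial derivatives commute with post-composition by a continuous linear map. [folklore] -/
theorem fderiv_clm_comp_left_apply {f : X → F} {x : X} (hf : DifferentiableAt ℝ f x)
    (L : F →L[ℝ] G) (v : X) :
    fderiv ℝ (fun y => L (f y)) x v = L (fderiv ℝ f x v) := by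
  rw [show (fun y => L (f y)) = L ∘ f from rfl, fderiv_comp x L.differentiableAt hf,
    ContinuousLinearMap.fderiv]
  rfl

end TestFields

section DivFreeAvg

/-- **The fibre integral of the horizontal part of a divergence-free test field is divergence
free**: `div_w ∫ π ψ(ι w + z e_z) dz = ∫ (div ψ − ∂_z ψ_z) dz = 0 − 0`. [folklore] -/
theorem isDivFree_vertInt_projXY {Ψ : ℝ³ → ℝ³} (hs : ContDiff ℝ ∞ Ψ) (hc : HasCompactSupport Ψ)
    (hdiv : VectorCalculus.IsDivFree Ψ) :
    VectorCalculus.IsDivFree (vertInt fun y => projXY (Ψ y)) := by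
  classical
  intro w
  set Φ : ℝ³ → ℝ² := fun y => projXY (Ψ y) with hΦ
  have hΦs : ContDiff ℝ ∞ Φ := projXY.contDiff.comp hs
  have hΦc : HasCompactSupport Φ := hc.comp_left (map_zero projXY)
  have hΨd : ∀ y, DifferentiableAt ℝ Ψ y := fun y => (hs.differentiable (by simp)) y
  rw [divergence_eq_sum_inner_fderiv (EuclideanSpace.basisFun (Fin 2) ℝ)]
  -- each planar partial as a fibre integral
  have hterm : ∀ i : Fin 2, ⟪EuclideanSpace.basisFun (Fin 2) ℝ i,
      fderiv ℝ (vertInt Φ) w (EuclideanSpace.basisFun (Fin 2) ℝ i)⟫ =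
      ∫ z : ℝ, ⟪EuclideanSpace.basisFun (Fin 3) ℝ (Fin.castSucc i),
        fderiv ℝ Ψ (embedXY w + z • eZ) (EuclideanSpace.basisFun (Fin 3) ℝ (Fin.castSucc i))⟫ := by
    intro i
    rw [fderiv_vertInt_apply hΦs hΦc, vertInt_apply, ← integral_inner]
    · refine integral_congr_ae (Eventually.of_forall fun z => ?_)
      simp only [hΦ]
      rw [fderiv_clm_comp_left_apply (hΨd _), ← inner_embedXY_left, EuclideanSpace.basisFun_apply,
        EuclideanSpace.basisFun_apply, embedXY_single]
    · exact integrable_fiber ((hΦs.continuous_fderiv (by simp)).clm_apply continuous_const)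
        (hΦc.fderiv_apply ℝ _) w
  simp_rw [hterm]
  -- integrability of the frame terms along the fibre
  have hint : ∀ j : Fin 3, Integrable (fun z : ℝ => ⟪EuclideanSpace.basisFun (Fin 3) ℝ j,
      fderiv ℝ Ψ (embedXY w + z • eZ) (EuclideanSpace.basisFun (Fin 3) ℝ j)⟫) := fun j =>
    integrable_fiber (Φ := fun y => ⟪EuclideanSpace.basisFun (Fin 3) ℝ j,
        fderiv ℝ Ψ y (EuclideanSpace.basisFun (Fin 3) ℝ j)⟫)
      (continuous_const.inner ((hs.continuous_fderiv (by simp)).clm_apply continuous_const))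
      (((hc.fderiv_apply ℝ _).comp_left (g := fun v : ℝ³ =>
        ⟪EuclideanSpace.basisFun (Fin 3) ℝ j, v⟫) (inner_zero_right _))) w
  rw [← integral_finsetSum _ fun i _ => hint (Fin.castSucc i)]
  -- pointwise: the planar trace is minus the vertical derivative of the vertical component
  have hpt : ∀ z : ℝ, ∑ i : Fin 2, ⟪EuclideanSpace.basisFun (Fin 3) ℝ (Fin.castSucc i),
      fderiv ℝ Ψ (embedXY w + z • eZ) (EuclideanSpace.basisFun (Fin 3) ℝ (Fin.castSucc i))⟫ =
      -fderiv ℝ (fun y => ⟪eZ, Ψ y⟫) (embedXY w + z • eZ) eZ := by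
    intro z
    have h0 := hdiv (embedXY w + z • eZ)
    rw [divergence_eq_sum_inner_fderiv (EuclideanSpace.basisFun (Fin 3) ℝ), Fin.sum_univ_castSucc]
      at h0
    have he : EuclideanSpace.basisFun (Fin 3) ℝ (Fin.last 2) = eZ := by
      rw [EuclideanSpace.basisFun_apply]; rfl
    rw [he] at h0
    rw [fderiv_inner_const_left_apply (hs.differentiable (by simp))]
    linarith
  simp_rw [hpt]
  rw [integral_neg, neg_eq_zero]
  have hv := vertInt_fderiv_eZ (Φ := fun y => ⟪eZ, Ψ y⟫) (contDiff_const.inner ℝ hs)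
    (by simp : (∞ : WithTop ℕ∞) ≠ 0)
    (hc.comp_left (g := fun v : ℝ³ => ⟪eZ, v⟫) (inner_zero_right _)) w
  rwa [vertInt_apply] at hv

end DivFreeAvg

section SliceIdentity

/-- A pairing `x ↦ ⟪b(x), g(x)⟫` of a bounded a.e. strongly measurable field with a continuous
compactly supported one is integrable. [folklore] -/
theorem integrable_inner_of_bound {X : Type*} [MeasurableSpace X] [TopologicalSpace X]
    [OpensMeasurableSpace X] [SecondCountableTopology X] {μ : Measure X}
    [IsFiniteMeasureOnCompacts μ] {E' : Type*} [NormedAddCommGroup E'] [InnerProductSpace ℝ E']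
    {b g : X → E'} (hb : AEStronglyMeasurable b μ) {C : ℝ} (hC : ∀ x, ‖b x‖ ≤ C)
    (hg : Continuous g) (hgc : HasCompactSupport g) :
    Integrable (fun x => ⟪b x, g x⟫) μ := by
  refine Integrable.mono' ((hg.integrable_of_hasCompactSupport hgc).norm.const_mul C)
    (hb.inner hg.aestronglyMeasurable) (Eventually.of_forall fun x => ?_)
  rw [Real.norm_eq_abs]
  exact (abs_real_inner_le_norm _ _).trans (mul_le_mul_of_nonneg_right (hC x) (norm_nonneg _))

/-- The nonlinear pairing `x ↦ ⟪b(x), A(x)(c(x))⟫` with `b, c` bounded a.e. strongly measurable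
and `A` a continuous compactly supported operator field is integrable. [folklore] -/
theorem integrable_inner_clm_apply_of_bound {X : Type*} [MeasurableSpace X] [TopologicalSpace X]
    [OpensMeasurableSpace X] [SecondCountableTopology X] {μ : Measure X}
    [IsFiniteMeasureOnCompacts μ] {E' : Type*} [NormedAddCommGroup E'] [InnerProductSpace ℝ E']
    {G : Type*} [NormedAddCommGroup G] [NormedSpace ℝ G]
    {b : X → E'} (hb : AEStronglyMeasurable b μ) {C : ℝ} (hC : ∀ x, ‖b x‖ ≤ C)
    {A : X → G →L[ℝ] E'} (hA : Continuous A) (hAc : HasCompactSupport A)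
    {c : X → G} (hc : AEStronglyMeasurable c μ) {C' : ℝ} (hC' : ∀ x, ‖c x‖ ≤ C') :
    Integrable (fun x => ⟪b x, A x (c x)⟫) μ := by
  refine Integrable.mono' (((hA.integrable_of_hasCompactSupport hAc).norm.const_mul C).mul_const C')
    (hb.inner (isBoundedBilinearMap_apply.continuous.comp_aestronglyMeasurable
      (hA.aestronglyMeasurable.prodMk hc))) (Eventually.of_forall fun x => ?_)
  rw [Real.norm_eq_abs]
  have h0 : 0 ≤ C := (norm_nonneg _).trans (hC x)
  calc |⟪b x, A x (c x)⟫| ≤ ‖b x‖ * ‖A x (c x)‖ := abs_real_inner_le_norm _ _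
    _ ≤ C * (‖A x‖ * ‖c x‖) := by
        gcongr
        · exact hC x
        · exact ContinuousLinearMap.le_opNorm _ _
    _ ≤ C * (‖A x‖ * C') := by gcongr; exact hC' x
    _ = C * ‖A x‖ * C' := by ring

variable {I : Set ℝ} {hI : IsOpen I}

/-- **The lifted pairing equals the planar pairing with the fibre-averaged test field** (one
time slice). For a bounded a.e. strongly measurable planar field `a`, a test field `ψ` on the
slab `I × ℝ³` and `ψ̄ = fiberInt (π ∘ ψ)`:
`∫ (⟪ã, ∂ₜψ⟫ + ⟪ã, (ã·∇)ψ⟫ + ν⟪ã, Δψ⟫) dx = ∫ (⟪a, ∂ₜψ̄⟫ + ⟪a, (a·∇)ψ̄⟫ + ν⟪a, Δψ̄⟫) dw`,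
`ã = ι ∘ a ∘ π` — Fubini over the vertical fibres and the commutation of `∂ₜ`, `D`, `Δ` with the
fibre integral (`PlanarLiftCalculus`). [folklore] -/
theorem integral_planarLift_pairing_eq {ψ : ℝ → ℝ³ → ℝ³} (hψ : IsSpaceTimeTestOn (slab ℝ³ I hI) ψ)
    {a : ℝ² → ℝ²} (ham : AEStronglyMeasurable a volume) {C : ℝ} (hC : ∀ w, ‖a w‖ ≤ C)
    (ν t : ℝ) :
    ∫ x : ℝ³, (⟪embedXY (a (projXY x)), timeDeriv ψ t x⟫ +
        ⟪embedXY (a (projXY x)), convect (fun x => embedXY (a (projXY x))) (ψ t) x⟫ +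
        ν * ⟪embedXY (a (projXY x)), Δ (ψ t) x⟫) =
      ∫ w : ℝ², (⟪a w, timeDeriv (fiberInt fun t x => projXY (ψ t x)) t w⟫ +
        ⟪a w, convect a ((fiberInt fun t x => projXY (ψ t x)) t) w⟫ +
        ν * ⟪a w, Δ ((fiberInt fun t x => projXY (ψ t x)) t) w⟫) := by
  set φ : ℝ → ℝ³ → ℝ² := fun t x => projXY (ψ t x) with hφdef
  have hφ : IsSpaceTimeTestOn (slab ℝ³ I hI) φ := hψ.clm_comp_left projXY
  have hφT : IsSpaceTimeTestOn (⊤ : Opens (ℝ × ℝ³)) φ := hφ.mono le_top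
  have hφs : ContDiff ℝ ∞ (φ t) := hφ.contDiff_slice t
  have hφc : HasCompactSupport (φ t) := hφ.hasCompactSupport_slice t
  have hψd : ∀ x, DifferentiableAt ℝ (ψ t) x := fun x =>
    ((hψ.contDiff_slice t).differentiable (by simp)) x
  have hψ2 : ∀ x, ContDiffAt ℝ 2 (ψ t) x := fun x =>
    (contDiff_infty.1 (hψ.contDiff_slice t) 2).contDiffAt
  -- the measurable bounded lifted coefficient
  have hbm : AEStronglyMeasurable (fun x : ℝ³ => a (projXY x)) volume := aestronglyMeasurable_comp_projXY ham
  have hbC : ∀ x : ℝ³, ‖a (projXY x)‖ ≤ C := fun x => hC _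
  -- Step 1: the integrand in terms of `φ`
  set H : ℝ³ → ℝ := fun x => ⟪a (projXY x), timeDeriv φ t x⟫ +
      ⟪a (projXY x), fderiv ℝ (φ t) x (embedXY (a (projXY x)))⟫ +
      ν * ⟪a (projXY x), Δ (φ t) x⟫ with hHdef
  have hH : ∀ x, ⟪embedXY (a (projXY x)), timeDeriv ψ t x⟫ +
      ⟪embedXY (a (projXY x)), convect (fun x => embedXY (a (projXY x))) (ψ t) x⟫ +
      ν * ⟪embedXY (a (projXY x)), Δ (ψ t) x⟫ = H x := by
    intro x
    simp only [hHdef, convect_apply, inner_embedXY_left]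
    rw [← hψ.timeDeriv_clm_comp_left projXY t x, ← fderiv_clm_comp_left_apply (hψd x) projXY,
      show projXY (Δ (ψ t) x) = Δ (φ t) x from ((hψ2 x).laplacian_CLM_comp_left).symm]
  simp_rw [hH]
  -- Step 2: integrability of `H` and Fubini over the fibres
  have hdt_c : Continuous (timeDeriv φ t) := (hφT.timeDeriv_top.contDiff_slice t).continuous
  have hdt_s : HasCompactSupport (timeDeriv φ t) := hφT.timeDeriv_top.hasCompactSupport_slice t
  have hD_c : Continuous (fderiv ℝ (φ t)) := hφs.continuous_fderiv (by simp)
  have hD_s : HasCompactSupport (fderiv ℝ (φ t)) := hφc.fderiv ℝ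
  have hL_c : Continuous (Δ (φ t)) := (hφT.laplacian_top.contDiff_slice t).continuous
  have hL_s : HasCompactSupport (Δ (φ t)) := hφT.laplacian_top.hasCompactSupport_slice t
  have hHi : Integrable H := by
    refine Integrable.add (Integrable.add ?_ ?_) (Integrable.const_mul ?_ ν)
    · exact integrable_inner_of_bound hbm hbC hdt_c hdt_s
    · exact integrable_inner_clm_apply_of_bound hbm hbC hD_c hD_s
        (embedXY.continuous.comp_aestronglyMeasurable hbm) (C' := C) fun x => by
          rw [norm_embedXY]; exact hC _
    · exact integrable_inner_of_bound hbm hbC hL_c hL_s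
  rw [integral_eq_integral_cylSplit, Measure.volume_eq_prod,
    integral_prod_symm _ (integrable_comp_cylSplit_symm_iff.2 hHi)]
  refine integral_congr_ae (Eventually.of_forall fun w => ?_)
  -- Step 3: the fibre integral at a fixed horizontal point `w`
  have hf1 : Integrable (fun z : ℝ => timeDeriv φ t (embedXY w + z • eZ)) :=
    integrable_fiber hdt_c hdt_s w
  have hf2 : Integrable (fun z : ℝ => fderiv ℝ (φ t) (embedXY w + z • eZ) (embedXY (a w))) :=
    integrable_fiber (hD_c.clm_apply continuous_const) (hφc.fderiv_apply ℝ _) w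
  have hf3 : Integrable (fun z : ℝ => Δ (φ t) (embedXY w + z • eZ)) :=
    integrable_fiber hL_c hL_s w
  have hHw : ∀ z : ℝ, H (cylSplit.symm (z, w)) = ⟪a w, timeDeriv φ t (embedXY w + z • eZ)⟫ +
      ⟪a w, fderiv ℝ (φ t) (embedXY w + z • eZ) (embedXY (a w))⟫ +
      ν * ⟪a w, Δ (φ t) (embedXY w + z • eZ)⟫ := fun z => by
    have hx : projXY (embedXY w + z • eZ) = w := by simp
    simp only [hHdef, cylSplit_symm_eq, hx]
  simp_rw [hHw]
  have h1 : Integrable (fun z : ℝ => ⟪a w, timeDeriv φ t (embedXY w + z • eZ)⟫) :=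
    hf1.const_inner _
  have h2 : Integrable (fun z : ℝ => ⟪a w, fderiv ℝ (φ t) (embedXY w + z • eZ) (embedXY (a w))⟫) :=
    hf2.const_inner _
  have h3 : Integrable (fun z : ℝ => ν * ⟪a w, Δ (φ t) (embedXY w + z • eZ)⟫) :=
    (hf3.const_inner _).const_mul ν
  have h12 : Integrable (fun z : ℝ => ⟪a w, timeDeriv φ t (embedXY w + z • eZ)⟫ +
      ⟪a w, fderiv ℝ (φ t) (embedXY w + z • eZ) (embedXY (a w))⟫) := h1.add h2
  rw [integral_add h12 h3, integral_add h1 h2, integral_const_mul,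
    integral_inner hf1, integral_inner hf2, integral_inner hf3]
  -- Step 4: recognise the derivatives of the fibre average
  congr 2
  · rw [hφ.timeDeriv_fiberInt t w]; rfl
  · rw [convect_apply, show fiberInt φ t = vertInt (φ t) from rfl, fderiv_vertInt_apply hφs hφc]
    rfl
  · rw [show fiberInt φ t = vertInt (φ t) from rfl, laplacian_vertInt hφs hφc]
    rfl

end SliceIdentity

section Assembly

/-- **Bounded weak Navier–Stokes solutions lift from `ℝ²` to `ℝ³`** (KNSS 2009, §4 (ii): the
class of bounded weak solutions; the planar case of Theorem 5.1 as a special three-dimensional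
flow, Majda–Bertozzi §2.3.1). If `u` is a bounded weak solution on `ℝ² × I` with viscosity `ν`,
then `planarLift u`, `(t, x) ↦ (u(t, x₀, x₁), 0)`, is a bounded weak solution on `ℝ³ × I`:
measurability and the bound transport along the quasi-measure-preserving projection; weak
divergence-freeness of a.e. slice lifts (`IsWeaklyDivFree.planarLift_slice`); and a
divergence-free test field `ψ` on `I × ℝ³` is tested against the lift by testing the planar,
divergence-free, fibre-averaged field `fiberInt (π ∘ ψ)` against `u`
(`integral_planarLift_pairing_eq`, `isDivFree_vertInt_projXY`). [folklore] -/
theorem IsBoundedWeakNSSolutionOn.planarLift {I : Set ℝ} {hI : IsOpen I} {ν : ℝ}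
    {u : ℝ → ℝ² → ℝ²} (h : IsBoundedWeakNSSolutionOn I hI ν u) :
    IsBoundedWeakNSSolutionOn I hI ν (planarLift u) := by
  obtain ⟨hmeas, ⟨C, hC⟩, hdiv, hweak⟩ := h
  -- a.e. time slice of `u` is a.e. strongly measurable
  have hsl : ∀ᵐ t ∂((volume : Measure ℝ).restrict I), AEStronglyMeasurable (u t) volume := by
    have h1 : AEStronglyMeasurable (uncurry u) (((volume : Measure ℝ).restrict I).prod volume) := by
      rw [Measure.restrict_prod_eq_prod_univ, ← Measure.volume_eq_prod]
      exact hmeas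
    exact h1.prodMk_left
  refine ⟨aestronglyMeasurable_uncurry_planarLift hmeas,
    ⟨C, fun t ht x => by rw [norm_planarLift]; exact hC t ht _⟩, ?_, fun ψ hψ hψdiv => ?_⟩
  · filter_upwards [hdiv, hsl, ae_restrict_mem hI.measurableSet] with t ht hm htI
    exact ht.planarLift_slice hm (hC t htI)
  · set ψ' : ℝ → ℝ² → ℝ² := fiberInt fun t x => projXY (ψ t x) with hψ'def
    have hψ' : IsSpaceTimeTestOn (slab ℝ² I hI) ψ' :=
      isSpaceTimeTestOn_fiberInt (hψ.clm_comp_left projXY)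
    have hψ'div : ∀ t, VectorCalculus.IsDivFree (ψ' t) := fun t =>
      isDivFree_vertInt_projXY (hψ.contDiff_slice t) (hψ.hasCompactSupport_slice t) (hψdiv t)
    rw [← hweak ψ' hψ' hψ'div]
    refine setIntegral_congr_ae hI.measurableSet ?_
    have hsl' : ∀ᵐ t ∂(volume : Measure ℝ), t ∈ I → AEStronglyMeasurable (u t) volume :=
      (ae_restrict_iff' hI.measurableSet).1 hsl
    filter_upwards [hsl'] with t ht htI
    exact integral_planarLift_pairing_eq hψ (ht htI) (hC t htI) ν t

end Assembly

end Literature.Analysis.FluidPDE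

end
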